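import Summits.QuantumFields.YangMills.Theorems.VirialFluxGapCentralLiftProximity
import HarnessLib

/-!
# Route `VirialFluxGap` (YangMills): SMALLNESS ON THE CENTRAL WINDOW — every wrap-block ∕ seam variable and every block average has small imaginary part,
# `|Im q_v|, |z_B| ≤ ρ + 16L²√F₀` (inputs `|p|², |z|² ≤ ρ'²` of the per-variable (E2) budget of the explicit central field; ⟨stmt-QuantumFields-24141⟩, free-hands)

Width seat `ym-line-sfw-p2-w3` g59 (cell ym-idea-1, free hands), `--supports stmt-QuantumFields-24141`.

On the central window of the assembler's package (fcl-p3 g41: slice `0` in comb gauge, `1 − Re(q(w_k))² ≤ ρ²` for the three wrap representatives, `1 − Re(q(P.2 0))² ≤ ρ²`,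
`F₀(P) ≤ t`) the comb shadow (✓`fd_slice_combShadow_le`, ✓`fd_seam_combShadow_le`) puts every wrap link of block `k` within `16L²√F₀` of `w_k` and every seam value
within `12L²√F₀` of `P.2 0`; hence
* `im_normSq_le_of_central` — `|Im q(U)|² ≤ ρ²` from `1 − Re(q U)² ≤ ρ²`;
* ★★ `im_wrap_le_of_window` — `√(Σ_a Im_a(q(P_{i,(x,k)}))²) ≤ ρ + 16L²·√F₀(P)` for `x_k = −1`; ★★ `im_seam_le_of_window` — `≤ ρ + 12L²·√F₀(P)` at every seam site;
* ★★ `blockIm_le_of_window`, `seamIm_le_of_window` — the same bounds for the block averages `z_k = blockIm (wrapBlock k) k P`, `z₄ = seamIm P` (Jensen, ✓`avg_sub_sq_le`).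
So with `ρ' := ρ + 16L²√t` the hypotheses `|p|² ≤ ρ'²`, `|z|² ≤ ρ'²` of ✓`central_trace_le` ∕ ⧗`centralDiv_wrap_le` hold at every variable of the window.

HONEST LABEL: elementary estimates; ⟨24141⟩ and ⟨22884⟩ stay OPEN; the Yang–Mills mass gap is NOT proved by this; no summit is proved by a line.  THEOREMS ONLY.

References: [cite: Luscher1983, §2]; [cite: CosteEtAl1985].
-/

set_option autoImplicit false

noncomputable section

open scoped Quaternion Matrix BigOperators
open Literature.MathematicalPhysics.QuantumFieldTheory hiding SU2
open Literature.MathematicalPhysics.QuantumLattice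

namespace Summit.QuantumFields.YangMills.Theorems.VirialFluxGap.CentralCoercivity

open Summit.QuantumFields.YangMills.Theorems.FemtoTransferGap
open Summit.QuantumFields.YangMills.Theorems.FemtoTransferGap.TT
open Summit.QuantumFields.YangMills.Theorems.FemtoTransferGap.TwoLattice
open Summit.QuantumFields.YangMills.Theorems.FemtoTransferGap.TwoLattice.Flat
open Summit.QuantumFields.YangMills.Theorems.VirialFluxGap.RingDeficit
open Summit.QuantumFields.YangMills.Theorems.VirialFluxGap.FrameDerivative
open Summit.QuantumFields.YangMills.Theorems.ToronValleyVolume.Lojasiewicz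

variable {L : ℕ} [NeZero L]

/-! ## §1 Imaginary parts of unit quaternions -/

section Quat

omit [NeZero L]

/-- For `U ∈ SU(2)`: `|Im q(U)|² = 1 − Re(q U)²`, so `1 − Re² ≤ ρ²` gives `|Im q(U)|² ≤ ρ²`. [folklore] -/
theorem im_normSq_le_of_central (U : SU2) {ρ : ℝ} (h : 1 - (su2Quat U).re ^ 2 ≤ ρ ^ 2) :
    (su2Quat U).imI ^ 2 + (su2Quat U).imJ ^ 2 + (su2Quat U).imK ^ 2 ≤ ρ ^ 2 := by
  have h1 : Quaternion.normSq (su2Quat U) = 1 := normSq_su2Quat U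
  rw [Quaternion.normSq_def'] at h1
  nlinarith [h1]

/-- Triangle inequality for imaginary parts in «sum of three squares» letters: if `Σ(Im b)² ≤ ρ²` (`ρ ≥ 0`) and `‖a − b‖ ≤ d` then `√(Σ(Im a)²) ≤ ρ + d`. [folklore] -/
theorem sqrt_im_sq_le_of_near (a b : ℍ) {ρ d : ℝ} (hρ : 0 ≤ ρ) (hb : b.imI ^ 2 + b.imJ ^ 2 + b.imK ^ 2 ≤ ρ ^ 2) (hab : ‖a - b‖ ≤ d) :
    Real.sqrt (a.imI ^ 2 + a.imJ ^ 2 + a.imK ^ 2) ≤ ρ + d := by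
  have hd : 0 ≤ d := (norm_nonneg _).trans hab
  have h1 : Real.sqrt (b.imI ^ 2 + b.imJ ^ 2 + b.imK ^ 2) ≤ ρ := by
    rw [← Real.sqrt_sq hρ]; exact Real.sqrt_le_sqrt hb
  have h2 : Real.sqrt ((a.imI - b.imI) ^ 2 + (a.imJ - b.imJ) ^ 2 + (a.imK - b.imK) ^ 2) ≤ d := by
    have h := im_sub_sq_le_norm_sub_sq a b
    calc Real.sqrt ((a.imI - b.imI) ^ 2 + (a.imJ - b.imJ) ^ 2 + (a.imK - b.imK) ^ 2) ≤ Real.sqrt (‖a - b‖ ^ 2) := Real.sqrt_le_sqrt h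
      _ = ‖a - b‖ := Real.sqrt_sq (norm_nonneg _)
      _ ≤ d := hab
  -- triangle inequality in `ℝ³` via `EuclideanSpace`-free algebra: `√(Σa²) ≤ √(Σb²) + √(Σ(a−b)²)`
  have h3 : Real.sqrt (a.imI ^ 2 + a.imJ ^ 2 + a.imK ^ 2) ≤
      Real.sqrt (b.imI ^ 2 + b.imJ ^ 2 + b.imK ^ 2) + Real.sqrt ((a.imI - b.imI) ^ 2 + (a.imJ - b.imJ) ^ 2 + (a.imK - b.imK) ^ 2) := by
    set sb := Real.sqrt (b.imI ^ 2 + b.imJ ^ 2 + b.imK ^ 2) with hsb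
    set sd := Real.sqrt ((a.imI - b.imI) ^ 2 + (a.imJ - b.imJ) ^ 2 + (a.imK - b.imK) ^ 2) with hsd
    have hsb0 : 0 ≤ sb := Real.sqrt_nonneg _
    have hsd0 : 0 ≤ sd := Real.sqrt_nonneg _
    have hsb2 : sb ^ 2 = b.imI ^ 2 + b.imJ ^ 2 + b.imK ^ 2 := Real.sq_sqrt (by positivity)
    have hsd2 : sd ^ 2 = (a.imI - b.imI) ^ 2 + (a.imJ - b.imJ) ^ 2 + (a.imK - b.imK) ^ 2 := Real.sq_sqrt (by positivity)
    -- Cauchy–Schwarz: `b·(a−b) ≤ sb·sd`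
    have hcs : (b.imI * (a.imI - b.imI) + b.imJ * (a.imJ - b.imJ) + b.imK * (a.imK - b.imK)) ≤ sb * sd := by
      have hsq := dot3_sq_le ![b.imI, b.imJ, b.imK] ![a.imI - b.imI, a.imJ - b.imJ, a.imK - b.imK]
      simp only [Matrix.cons_val_zero, Matrix.cons_val_one, Matrix.head_cons, Matrix.cons_val_two, Matrix.tail_cons] at hsq
      rw [← hsb2, ← hsd2, ← mul_pow] at hsq
      exact abs_le_of_sq_le_sq' hsq (mul_nonneg hsb0 hsd0) |>.2
    have hle : a.imI ^ 2 + a.imJ ^ 2 + a.imK ^ 2 ≤ (sb + sd) ^ 2 := by nlinarith [hsb2, hsd2, hcs]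
    calc Real.sqrt (a.imI ^ 2 + a.imJ ^ 2 + a.imK ^ 2) ≤ Real.sqrt ((sb + sd) ^ 2) := Real.sqrt_le_sqrt hle
      _ = sb + sd := Real.sqrt_sq (by positivity)
  linarith

end Quat

/-! ## §2 The variables on the central window -/

/-- ★★ **Wrap links on the central window**: with slice `0` in comb gauge and `1 − Re(q(w_k))² ≤ ρ²` (`ρ ≥ 0`), every wrap link `(x,k)`, `x_k = −1`, of every slice
has `√(Σ_a Im_a(q(P_{i,(x,k)}))²) ≤ ρ + 16L²·√F₀(P)`. [cite: Luscher1983, §2] -/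
theorem im_wrap_le_of_window (P : (Fin (2 * L - 1 + 1) → GaugeConfig 3 L SU2) × (Site 3 L → SU2)) (ht : treeGauge (P.1 0) = 1)
    {ρ : ℝ} (hρ : 0 ≤ ρ) {k : Fin 3} (hcen : 1 - (su2Quat (wrapReps (P.1 0) k)).re ^ 2 ≤ ρ ^ 2)
    (i : Fin (2 * L - 1 + 1)) {x : Site 3 L} (hx : x k = -1) :
    Real.sqrt ((su2Quat (P.1 i (x, k))).imI ^ 2 + (su2Quat (P.1 i (x, k))).imJ ^ 2 + (su2Quat (P.1 i (x, k))).imK ^ 2) ≤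
      ρ + 16 * (L : ℝ) ^ 2 * Real.sqrt (ringDeficit L (fun _ => false) P) := by
  have hL1 : (1 : ℝ) ≤ L := by exact_mod_cast NeZero.one_le
  have hδ0 : 0 ≤ Real.sqrt (ringDeficit L (fun _ => false) P) := Real.sqrt_nonneg _
  have h1 := fd_slice_combShadow_le P ht i (x, k)
  rw [combFlat_apply] at h1
  simp only [hx, if_true] at h1
  have h2 : fd (P.1 i (x, k)) (wrapReps (P.1 0) k) ≤ 16 * (L : ℝ) ^ 2 * Real.sqrt (ringDeficit L (fun _ => false) P) :=
    h1.trans (mul_le_mul_of_nonneg_right (four_add_twelve_sq_le hL1) hδ0)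
  have h3 : ‖su2Quat (P.1 i (x, k)) - su2Quat (wrapReps (P.1 0) k)‖ ≤ 16 * (L : ℝ) ^ 2 * Real.sqrt (ringDeficit L (fun _ => false) P) :=
    (norm_su2Quat_sub_le_fd _ _).trans h2
  exact sqrt_im_sq_le_of_near _ _ hρ (im_normSq_le_of_central _ hcen) h3

/-- ★★ **Seam values on the central window**: `√(Σ_a Im_a(q(P.2 x))²) ≤ ρ + 12L²·√F₀(P)` at every site. [cite: Luscher1983, §2] -/
theorem im_seam_le_of_window (P : (Fin (2 * L - 1 + 1) → GaugeConfig 3 L SU2) × (Site 3 L → SU2)) (ht : treeGauge (P.1 0) = 1)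
    {ρ : ℝ} (hρ : 0 ≤ ρ) (hcen : 1 - (su2Quat (P.2 0)).re ^ 2 ≤ ρ ^ 2) (x : Site 3 L) :
    Real.sqrt ((su2Quat (P.2 x)).imI ^ 2 + (su2Quat (P.2 x)).imJ ^ 2 + (su2Quat (P.2 x)).imK ^ 2) ≤
      ρ + 12 * (L : ℝ) ^ 2 * Real.sqrt (ringDeficit L (fun _ => false) P) := by
  have h2 := fd_seam_combShadow_le P ht x
  have h3 : ‖su2Quat (P.2 x) - su2Quat (P.2 0)‖ ≤ 12 * (L : ℝ) ^ 2 * Real.sqrt (ringDeficit L (fun _ => false) P) :=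
    (norm_su2Quat_sub_le_fd _ _).trans h2
  exact sqrt_im_sq_le_of_near _ _ hρ (im_normSq_le_of_central _ hcen) h3

/-- From `√S ≤ R` (`S ≥ 0`) to `S ≤ R²`. [folklore] -/
theorem le_sq_of_sqrt_le {S R : ℝ} (hS : 0 ≤ S) (h : Real.sqrt S ≤ R) : S ≤ R ^ 2 := by
  have hR : 0 ≤ R := (Real.sqrt_nonneg _).trans h
  calc S = Real.sqrt S ^ 2 := (Real.sq_sqrt hS).symm
    _ ≤ R ^ 2 := pow_le_pow_left₀ (Real.sqrt_nonneg _) h 2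

/-- ★★ **The wrap-block average on the central window**: `Σ_a (blockIm (wrapBlock k) k P a)² ≤ (ρ + 16L²√F₀(P))²` (Jensen over the block). [cite: CosteEtAl1985] -/
theorem blockIm_le_of_window (P : (Fin (2 * L - 1 + 1) → GaugeConfig 3 L SU2) × (Site 3 L → SU2)) (ht : treeGauge (P.1 0) = 1)
    {ρ : ℝ} (hρ : 0 ≤ ρ) (k : Fin 3) (hcen : 1 - (su2Quat (wrapReps (P.1 0) k)).re ^ 2 ≤ ρ ^ 2) :
    (blockIm L (wrapBlock L k) k P 0) ^ 2 + (blockIm L (wrapBlock L k) k P 1) ^ 2 + (blockIm L (wrapBlock L k) k P 2) ^ 2 ≤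
      (ρ + 16 * (L : ℝ) ^ 2 * Real.sqrt (ringDeficit L (fun _ => false) P)) ^ 2 := by
  have hlink : ∀ v ∈ wrapBlock L k, ((su2Quat (P.1 v.1 (v.2, k))).imI - 0) ^ 2 + ((su2Quat (P.1 v.1 (v.2, k))).imJ - 0) ^ 2 +
      ((su2Quat (P.1 v.1 (v.2, k))).imK - 0) ^ 2 ≤ (ρ + 16 * (L : ℝ) ^ 2 * Real.sqrt (ringDeficit L (fun _ => false) P)) ^ 2 := by
    intro v hv
    have hvk : v.2 k = -1 := (mem_wrapBlock k v).1 hv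
    have h := le_sq_of_sqrt_le (by positivity) (im_wrap_le_of_window P ht hρ hcen v.1 hvk)
    simpa using h
  have havg := avg_sub_sq_le (wrapBlock L k) (wrapBlock_nonempty k)
    (fun v => ![(su2Quat (P.1 v.1 (v.2, k))).imI, (su2Quat (P.1 v.1 (v.2, k))).imJ, (su2Quat (P.1 v.1 (v.2, k))).imK])
    ![(0 : ℝ), 0, 0] (R := (ρ + 16 * (L : ℝ) ^ 2 * Real.sqrt (ringDeficit L (fun _ => false) P)) ^ 2) (fun v hv => by simpa using hlink v hv)
  obtain ⟨hb0, hb1, hb2⟩ := blockIm_apply (wrapBlock L k) k P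
  rw [hb0, hb1, hb2]
  simpa using havg

/-- ★★ **The seam average on the central window**: `Σ_a (seamIm P a)² ≤ (ρ + 12L²√F₀(P))²`. [cite: CosteEtAl1985] -/
theorem seamIm_le_of_window (P : (Fin (2 * L - 1 + 1) → GaugeConfig 3 L SU2) × (Site 3 L → SU2)) (ht : treeGauge (P.1 0) = 1)
    {ρ : ℝ} (hρ : 0 ≤ ρ) (hcen : 1 - (su2Quat (P.2 0)).re ^ 2 ≤ ρ ^ 2) :
    (seamIm L P 0) ^ 2 + (seamIm L P 1) ^ 2 + (seamIm L P 2) ^ 2 ≤ (ρ + 12 * (L : ℝ) ^ 2 * Real.sqrt (ringDeficit L (fun _ => false) P)) ^ 2 := by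
  have hlink : ∀ x ∈ (Finset.univ : Finset (Site 3 L)), ((su2Quat (P.2 x)).imI - 0) ^ 2 + ((su2Quat (P.2 x)).imJ - 0) ^ 2 + ((su2Quat (P.2 x)).imK - 0) ^ 2 ≤
      (ρ + 12 * (L : ℝ) ^ 2 * Real.sqrt (ringDeficit L (fun _ => false) P)) ^ 2 := by
    intro x _
    have h := le_sq_of_sqrt_le (by positivity) (im_seam_le_of_window P ht hρ hcen x)
    simpa using h
  have havg := avg_sub_sq_le (Finset.univ : Finset (Site 3 L)) Finset.univ_nonempty
    (fun x => ![(su2Quat (P.2 x)).imI, (su2Quat (P.2 x)).imJ, (su2Quat (P.2 x)).imK]) ![(0 : ℝ), 0, 0]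
    (R := (ρ + 12 * (L : ℝ) ^ 2 * Real.sqrt (ringDeficit L (fun _ => false) P)) ^ 2) (fun x hx => by simpa using hlink x hx)
  obtain ⟨hb0, hb1, hb2⟩ := seamIm_apply P
  rw [hb0, hb1, hb2]
  simpa using havg

end Summit.QuantumFields.YangMills.Theorems.VirialFluxGap.CentralCoercivity

end
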